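import Mathlib
import HarnessLib
import Summits.KontsevichZagierPeriods.Zeta5Search.SorokinLastVariable

/-!
# ζ(5) search — Zudilin's `J_k` along a complex line of parameters: pointwise structure and majorant (cell `pub-zeta5`, ct-1 g27)

HONEST FRAMING: systematic search; no irrationality claim unless kernel-certified.  Pointwise identities and inequalities for the
complex-parameter integrand of the typed `Zudilin2002.sorokinIntegral` (written inline); nothing here is an irrationality result,
a worthiness exponent or a denominator statement; no named fact is discharged; no definition is introduced.

Toward the two analytic continuations in the parameters of Zudilin's induction (math/0206177, "(12) can be removed by the theory of
analytic continuation"; `HOME/ct-1/g26/VWP-BLUEPRINT.md`, B6): along a complex line of parameters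
`t ↦ (a₀ + t u₀; a_j + t u_j | b_j + t v_j)` the integrand factorises as

  `F_t(x) = F_0(x) · exp(t · L(x))`,   `L(x) = Σ_j (u_j log x_j + (v_j − u_j) log(1 − x_j)) − u₀ log Q_k(x)`

(`integrand_line_eq`), so `∂_t F_t = F_0 · L · e^{tL}`; and on the open cube, for `‖t‖ ≤ ρ`,

  `‖F_0(x) · L(x) · e^{tL(x)}‖ ≤ (M/δ) · [typed real integrand at (Re a₀ + η; Re a_j − η | Re b_j − 2η)](x)`

whenever `δ + ρM ≤ η` (`norm_deriv_le`; `M = ‖u₀‖ + Σ_j(‖u_j‖ + ‖v_j − u_j‖)`, `|log y| ≤ y^{−δ}/δ` on `(0,1]`).  The sequel file turns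
this into holomorphy of `t ↦ J_k` by dominated differentiation.  Theorems only; imports `Zeta5Search/SorokinLastVariable`.
-/

noncomputable section

namespace Summit.KontsevichZagierPeriods.Zeta5Search.SorokinParameterLine

open MeasureTheory Set Filter
open Literature.NumberTheory.Irrationality.Zudilin2002 (nestedQ sorokinIntegrand)
open Summit.KontsevichZagierPeriods.Zeta5Search.SorokinIntegrandBounds
open Summit.KontsevichZagierPeriods.Zeta5Search.SorokinLastVariable

/-! ### 1. Elementary one-variable facts on `(0,1]` -/

/-- `z^{p + w} = z^{p} · exp(log z · w)` for `z ≠ 0`. -/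
theorem cpow_add_eq_mul_exp {z : ℂ} (hz : z ≠ 0) (p w : ℂ) : z ^ (p + w) = z ^ p * Complex.exp (Complex.log z * w) := by
  rw [Complex.cpow_add _ _ hz, Complex.cpow_def_of_ne_zero hz w]

/-- For `c ∈ (0,1]`, `‖t‖ ≤ ρ`: `Re(t · (w · log c)) ≤ −ρ‖w‖ log c`. -/
theorem re_mul_log_le {c : ℝ} (hc : 0 < c) (hc1 : c ≤ 1) {t : ℂ} {ρ : ℝ} (ht : ‖t‖ ≤ ρ) (w : ℂ) :
    (t * (w * Complex.log (c : ℂ))).re ≤ -(ρ * ‖w‖) * Real.log c := by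
  rw [← Complex.ofReal_log hc.le, ← mul_assoc, Complex.re_mul_ofReal]
  have hlog : Real.log c ≤ 0 := Real.log_nonpos hc.le hc1
  have hre : -(ρ * ‖w‖) ≤ (t * w).re := by
    have h1 : |(t * w).re| ≤ ‖t * w‖ := Complex.abs_re_le_norm _
    rw [norm_mul] at h1
    have h2 : ‖t‖ * ‖w‖ ≤ ρ * ‖w‖ := mul_le_mul_of_nonneg_right ht (norm_nonneg _)
    linarith [neg_abs_le (t * w).re]
  exact mul_le_mul_of_nonpos_right hre hlog

/-- For `c ∈ (0,1]` and `δ > 0`: `|log c| ≤ c^{−δ}/δ`. -/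
theorem abs_log_le_rpow {c δ : ℝ} (hc : 0 < c) (hc1 : c ≤ 1) (hδ : 0 < δ) : |Real.log c| ≤ c ^ (-δ) / δ := by
  rw [abs_of_nonpos (Real.log_nonpos hc.le hc1), ← Real.log_inv, Real.rpow_neg hc.le, ← Real.inv_rpow hc.le]
  exact Real.log_le_rpow_div (inv_nonneg.2 hc.le) hδ

/-- For `c ∈ (0,1]` and `e ≥ 0`: `1 ≤ c^{−e}`. -/
theorem one_le_rpow_neg {c e : ℝ} (hc : 0 < c) (hc1 : c ≤ 1) (he : 0 ≤ e) : 1 ≤ c ^ (-e) :=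
  Real.one_le_rpow_of_pos_of_le_one_of_nonpos hc hc1 (by linarith)

/-! ### 2. The factorisation along a line -/

/-- **`F_t = F_0 · e^{tL}`** on the open cube: the integrand at the parameters `(a₀ + t u₀; a_j + t u_j | b_j + t v_j)` is the
integrand at `t = 0` times `exp(t · L(x))`, `L(x) = Σ_j (u_j log x_j + (v_j − u_j) log(1 − x_j)) − u₀ log Q_k(x)`. -/
theorem integrand_line_eq {k : ℕ} (a₀ u₀ : ℂ) (a b u v : ℕ → ℂ) (t : ℂ) {x : Fin k → ℝ} (hx : ∀ j, x j ∈ Ioo (0 : ℝ) 1)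
    (hQ : 0 < nestedQ (List.ofFn x)) :
    (∏ j : Fin k, ((x j : ℝ) : ℂ) ^ ((a j + t * u j) - 1) *
          (1 - ((x j : ℝ) : ℂ)) ^ ((b j + t * v j) - (a j + t * u j) - 1)) *
        ((nestedQ (List.ofFn x) : ℝ) : ℂ) ^ (-(a₀ + t * u₀)) =
      ((∏ j : Fin k, ((x j : ℝ) : ℂ) ^ (a j - 1) * (1 - ((x j : ℝ) : ℂ)) ^ (b j - a j - 1)) *
          ((nestedQ (List.ofFn x) : ℝ) : ℂ) ^ (-a₀)) *
        Complex.exp (t * ((∑ j : Fin k, (u j * Complex.log ((x j : ℝ) : ℂ) + (v j - u j) * Complex.log (1 - ((x j : ℝ) : ℂ)))) +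
          -u₀ * Complex.log ((nestedQ (List.ofFn x) : ℝ) : ℂ))) := by
  have hxz : ∀ j, ((x j : ℝ) : ℂ) ≠ 0 := fun j => by exact_mod_cast (hx j).1.ne'
  have h1z : ∀ j, (1 : ℂ) - ((x j : ℝ) : ℂ) ≠ 0 := fun j => by
    rw [show (1 : ℂ) - ((x j : ℝ) : ℂ) = ((1 - x j : ℝ) : ℂ) by push_cast; ring]
    exact_mod_cast (by linarith [(hx j).2] : (1 - x j : ℝ) ≠ 0)
  have hQz : ((nestedQ (List.ofFn x) : ℝ) : ℂ) ≠ 0 := by exact_mod_cast hQ.ne'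
  -- factor by factor
  have hj : ∀ j : Fin k, ((x j : ℝ) : ℂ) ^ ((a j + t * u j) - 1) * (1 - ((x j : ℝ) : ℂ)) ^ ((b j + t * v j) - (a j + t * u j) - 1) =
      (((x j : ℝ) : ℂ) ^ (a j - 1) * (1 - ((x j : ℝ) : ℂ)) ^ (b j - a j - 1)) *
        Complex.exp (t * (u j * Complex.log ((x j : ℝ) : ℂ) + (v j - u j) * Complex.log (1 - ((x j : ℝ) : ℂ)))) := by
    intro j
    rw [show (a j + t * u j) - 1 = (a j - 1) + t * u j by ring,
      show (b j + t * v j) - (a j + t * u j) - 1 = (b j - a j - 1) + t * (v j - u j) by ring,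
      cpow_add_eq_mul_exp (hxz j), cpow_add_eq_mul_exp (h1z j), mul_add, Complex.exp_add]
    ring_nf
  have hQ' : ((nestedQ (List.ofFn x) : ℝ) : ℂ) ^ (-(a₀ + t * u₀)) =
      ((nestedQ (List.ofFn x) : ℝ) : ℂ) ^ (-a₀) * Complex.exp (t * (-u₀ * Complex.log ((nestedQ (List.ofFn x) : ℝ) : ℂ))) := by
    rw [show -(a₀ + t * u₀) = -a₀ + t * (-u₀) by ring, cpow_add_eq_mul_exp hQz]
    ring_nf
  rw [Finset.prod_congr rfl fun j _ => hj j, Finset.prod_mul_distrib, ← Complex.exp_sum, hQ', mul_add t, Complex.exp_add,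
    Finset.mul_sum]
  ring

/-! ### 3. The majorant -/

/-- The real exponential weight: `‖exp(t L(x))‖ ≤ ∏_j x_j^{−ρ‖u_j‖}(1−x_j)^{−ρ‖v_j−u_j‖} · Q^{−ρ‖u₀‖}` for `‖t‖ ≤ ρ`. -/
theorem norm_exp_line_le {k : ℕ} (u₀ : ℂ) (u v : ℕ → ℂ) {t : ℂ} {ρ : ℝ} (ht : ‖t‖ ≤ ρ) {x : Fin k → ℝ}
    (hx : ∀ j, x j ∈ Ioo (0 : ℝ) 1) {Q : ℝ} (hQ : 0 < Q) (hQ1 : Q ≤ 1) :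
    ‖Complex.exp (t * ((∑ j : Fin k, (u j * Complex.log ((x j : ℝ) : ℂ) + (v j - u j) * Complex.log (1 - ((x j : ℝ) : ℂ)))) +
          -u₀ * Complex.log ((Q : ℝ) : ℂ)))‖ ≤
      (∏ j : Fin k, x j ^ (-(ρ * ‖u j‖)) * (1 - x j) ^ (-(ρ * ‖v j - u j‖))) * Q ^ (-(ρ * ‖u₀‖)) := by
  rw [Complex.norm_exp]
  have hsplit : (t * ((∑ j : Fin k, (u j * Complex.log ((x j : ℝ) : ℂ) + (v j - u j) * Complex.log (1 - ((x j : ℝ) : ℂ)))) +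
        -u₀ * Complex.log ((Q : ℝ) : ℂ))).re =
      (∑ j : Fin k, ((t * (u j * Complex.log ((x j : ℝ) : ℂ))).re + (t * ((v j - u j) * Complex.log (((1 - x j : ℝ)) : ℂ))).re)) +
        (t * (-u₀ * Complex.log ((Q : ℝ) : ℂ))).re := by
    rw [mul_add, Complex.add_re, Finset.mul_sum, Complex.re_sum]
    congr 1
    refine Finset.sum_congr rfl fun j _ => ?_
    rw [mul_add, Complex.add_re]
    push_cast
    ring_nf
  rw [hsplit, Real.exp_add, Real.exp_sum]
  refine mul_le_mul ?_ ?_ (Real.exp_pos _).le (Finset.prod_nonneg fun j _ => mul_nonneg (Real.rpow_nonneg (hx j).1.le _)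
    (Real.rpow_nonneg (by linarith [(hx j).2]) _))
  · refine Finset.prod_le_prod (fun j _ => (Real.exp_pos _).le) fun j _ => ?_
    have h0 := hx j
    have h1 : 0 < 1 - x j := by linarith [h0.2]
    rw [Real.exp_add, Real.rpow_def_of_pos h0.1, Real.rpow_def_of_pos h1]
    refine mul_le_mul (Real.exp_le_exp.2 ?_) (Real.exp_le_exp.2 ?_) (Real.exp_pos _).le (Real.exp_pos _).le
    · have := re_mul_log_le h0.1 h0.2.le ht (u j); linarith
    · have := re_mul_log_le h1 (by linarith [h0.1]) ht (v j - u j); linarith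
  · rw [Real.rpow_def_of_pos hQ]
    refine Real.exp_le_exp.2 ?_
    have := re_mul_log_le hQ hQ1 ht (-u₀)
    rw [norm_neg] at this
    linarith

/-- The logarithmic factor: `‖L(x)‖ ≤ (M/δ) · ∏_j x_j^{−δ}(1−x_j)^{−δ} · Q^{−δ}`, `M = ‖u₀‖ + Σ_j(‖u_j‖ + ‖v_j − u_j‖)`, `δ > 0`. -/
theorem norm_L_le {k : ℕ} (u₀ : ℂ) (u v : ℕ → ℂ) {x : Fin k → ℝ} (hx : ∀ j, x j ∈ Ioo (0 : ℝ) 1) {Q : ℝ} (hQ : 0 < Q)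
    (hQ1 : Q ≤ 1) {δ : ℝ} (hδ : 0 < δ) :
    ‖(∑ j : Fin k, (u j * Complex.log ((x j : ℝ) : ℂ) + (v j - u j) * Complex.log (1 - ((x j : ℝ) : ℂ)))) +
        -u₀ * Complex.log ((Q : ℝ) : ℂ)‖ ≤
      ((‖u₀‖ + ∑ j : Fin k, (‖u j‖ + ‖v j - u j‖)) / δ) *
        ((∏ j : Fin k, x j ^ (-δ) * (1 - x j) ^ (-δ)) * Q ^ (-δ)) := by
  set P : ℝ := (∏ j : Fin k, x j ^ (-δ) * (1 - x j) ^ (-δ)) * Q ^ (-δ) with hP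
  have h1x : ∀ j, 0 < 1 - x j := fun j => by linarith [(hx j).2]
  have hfac : ∀ j, 1 ≤ x j ^ (-δ) * (1 - x j) ^ (-δ) := fun j =>
    one_le_mul_of_one_le_of_one_le (one_le_rpow_neg (hx j).1 (hx j).2.le hδ.le)
      (one_le_rpow_neg (h1x j) (by linarith [(hx j).1]) hδ.le)
  have hQδ : 1 ≤ Q ^ (-δ) := one_le_rpow_neg hQ hQ1 hδ.le
  -- `1 ≤ ∏ f` for real factors `≥ 1` (the tree's `Literature.NumberTheory.Sieve.GoldbachLinnik.one_le_prod_real`, inlined)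
  have one_le_prod : ∀ s : Finset (Fin k), 1 ≤ ∏ i ∈ s, x i ^ (-δ) * (1 - x i) ^ (-δ) := fun s =>
    calc (1 : ℝ) = ∏ _i ∈ s, (1 : ℝ) := by simp
      _ ≤ ∏ i ∈ s, x i ^ (-δ) * (1 - x i) ^ (-δ) := Finset.prod_le_prod (fun _ _ => zero_le_one) fun i _ => hfac i
  have hprod1 : 1 ≤ ∏ j : Fin k, x j ^ (-δ) * (1 - x j) ^ (-δ) := one_le_prod _
  have hP1 : ∀ j : Fin k, x j ^ (-δ) ≤ P ∧ (1 - x j) ^ (-δ) ≤ P := by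
    intro j
    have herase : ∏ i : Fin k, x i ^ (-δ) * (1 - x i) ^ (-δ) =
        (x j ^ (-δ) * (1 - x j) ^ (-δ)) * ∏ i ∈ Finset.univ.erase j, x i ^ (-δ) * (1 - x i) ^ (-δ) :=
      (Finset.mul_prod_erase _ _ (Finset.mem_univ j)).symm
    have hrest : 1 ≤ ∏ i ∈ Finset.univ.erase j, x i ^ (-δ) * (1 - x i) ^ (-δ) := one_le_prod _
    have ha : 0 ≤ x j ^ (-δ) := Real.rpow_nonneg (hx j).1.le _
    have hb : 0 ≤ (1 - x j) ^ (-δ) := Real.rpow_nonneg (h1x j).le _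
    have hxj : 1 ≤ x j ^ (-δ) := one_le_rpow_neg (hx j).1 (hx j).2.le hδ.le
    have h1j : 1 ≤ (1 - x j) ^ (-δ) := one_le_rpow_neg (h1x j) (by linarith [(hx j).1]) hδ.le
    rw [hP, herase]
    constructor <;> nlinarith [mul_nonneg ha hb, mul_nonneg (mul_nonneg ha hb) (le_trans zero_le_one hrest)]
  have hPQ : Q ^ (-δ) ≤ P := by
    rw [hP]; nlinarith [le_trans zero_le_one hQδ]
  have hP0 : 0 ≤ P := le_trans (Real.rpow_nonneg hQ.le _) hPQ
  -- termwise bounds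
  have hlogx : ∀ j : Fin k, ‖Complex.log ((x j : ℝ) : ℂ)‖ ≤ P / δ := fun j => by
    rw [← Complex.ofReal_log (hx j).1.le, Complex.norm_real, Real.norm_eq_abs]
    exact (abs_log_le_rpow (hx j).1 (hx j).2.le hδ).trans (div_le_div_of_nonneg_right (hP1 j).1 hδ.le)
  have hlog1 : ∀ j : Fin k, ‖Complex.log (1 - ((x j : ℝ) : ℂ))‖ ≤ P / δ := fun j => by
    rw [show (1 : ℂ) - ((x j : ℝ) : ℂ) = ((1 - x j : ℝ) : ℂ) by push_cast; ring, ← Complex.ofReal_log (h1x j).le,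
      Complex.norm_real, Real.norm_eq_abs]
    exact (abs_log_le_rpow (h1x j) (by linarith [(hx j).1]) hδ).trans (div_le_div_of_nonneg_right (hP1 j).2 hδ.le)
  have hlogQ : ‖Complex.log ((Q : ℝ) : ℂ)‖ ≤ P / δ := by
    rw [← Complex.ofReal_log hQ.le, Complex.norm_real, Real.norm_eq_abs]
    exact (abs_log_le_rpow hQ hQ1 hδ).trans (div_le_div_of_nonneg_right hPQ hδ.le)
  calc _ ≤ ‖∑ j : Fin k, (u j * Complex.log ((x j : ℝ) : ℂ) + (v j - u j) * Complex.log (1 - ((x j : ℝ) : ℂ)))‖ +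
          ‖-u₀ * Complex.log ((Q : ℝ) : ℂ)‖ := norm_add_le _ _
    _ ≤ (∑ j : Fin k, (‖u j‖ * (P / δ) + ‖v j - u j‖ * (P / δ))) + ‖u₀‖ * (P / δ) := by
        refine add_le_add ((norm_sum_le _ _).trans (Finset.sum_le_sum fun j _ => (norm_add_le _ _).trans ?_)) ?_
        · rw [norm_mul, norm_mul]
          exact add_le_add (mul_le_mul_of_nonneg_left (hlogx j) (norm_nonneg _))
            (mul_le_mul_of_nonneg_left (hlog1 j) (norm_nonneg _))
        · rw [norm_mul, norm_neg]
          exact mul_le_mul_of_nonneg_left hlogQ (norm_nonneg _)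
    _ = _ := by
        simp_rw [← add_mul]
        rw [← Finset.sum_mul, hP]
        ring

/-- Merging real powers: the typed real integrand times the weight `∏ x_j^{−e}(1−x_j)^{−e}·Q^{−e}` is the typed real integrand at
the shifted parameters `(α₀ + e; α_j − e | β_j − 2e)`. -/
theorem sorokinIntegrand_mul_weight (k : ℕ) (α₀ e : ℝ) (α β : ℕ → ℝ) {x : Fin k → ℝ} (hx : ∀ j, x j ∈ Ioo (0 : ℝ) 1)
    (hQ : 0 < nestedQ (List.ofFn x)) :
    sorokinIntegrand k α₀ α β x * ((∏ j : Fin k, x j ^ (-e) * (1 - x j) ^ (-e)) * nestedQ (List.ofFn x) ^ (-e)) =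
      sorokinIntegrand k (α₀ + e) (fun n => α n - e) (fun n => β n - 2 * e) x := by
  have hxc : ∀ j, x j ∈ Icc (0 : ℝ) 1 := fun j => Ioo_subset_Icc_self (hx j)
  rw [sorokinIntegrand_eq k _ _ _ hxc, sorokinIntegrand_eq k _ _ _ hxc, neg_zero, Real.rpow_zero, mul_one, mul_one]
  calc (∏ j : Fin k, x j ^ (α j - 1) * (1 - x j) ^ (β j - α j - 1)) * nestedQ (List.ofFn x) ^ (-α₀) *
          ((∏ j : Fin k, x j ^ (-e) * (1 - x j) ^ (-e)) * nestedQ (List.ofFn x) ^ (-e))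
      = (∏ j : Fin k, (x j ^ (α j - 1) * (1 - x j) ^ (β j - α j - 1)) * (x j ^ (-e) * (1 - x j) ^ (-e))) *
          (nestedQ (List.ofFn x) ^ (-α₀) * nestedQ (List.ofFn x) ^ (-e)) := by
        have hd : (∏ j : Fin k, (x j ^ (α j - 1) * (1 - x j) ^ (β j - α j - 1)) * (x j ^ (-e) * (1 - x j) ^ (-e))) =
            (∏ j : Fin k, x j ^ (α j - 1) * (1 - x j) ^ (β j - α j - 1)) * ∏ j : Fin k, x j ^ (-e) * (1 - x j) ^ (-e) :=
          Finset.prod_mul_distrib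
        rw [hd]; ring
    _ = _ := by
        rw [← Real.rpow_add hQ, show -α₀ + -e = -(α₀ + e) by ring]
        congr 1
        refine Finset.prod_congr rfl fun j _ => ?_
        have h0 := (hx j).1
        have h1 : 0 < 1 - x j := by linarith [(hx j).2]
        rw [mul_mul_mul_comm, ← Real.rpow_add h0, ← Real.rpow_add h1]
        congr 2 <;> ring

/-- Monotonicity of the weight in the exponent: `e ≤ e'` ⇒ `∏ x_j^{−e}(1−x_j)^{−e}Q^{−e} ≤ ∏ x_j^{−e'}(1−x_j)^{−e'}Q^{−e'}`. -/
theorem weight_mono {k : ℕ} {e e' : ℝ} (hee : e ≤ e') {x : Fin k → ℝ} (hx : ∀ j, x j ∈ Ioo (0 : ℝ) 1) {Q : ℝ} (hQ : 0 < Q)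
    (hQ1 : Q ≤ 1) :
    (∏ j : Fin k, x j ^ (-e) * (1 - x j) ^ (-e)) * Q ^ (-e) ≤ (∏ j : Fin k, x j ^ (-e') * (1 - x j) ^ (-e')) * Q ^ (-e') := by
  have h1x : ∀ j, 0 < 1 - x j := fun j => by linarith [(hx j).2]
  refine mul_le_mul (Finset.prod_le_prod (fun j _ => mul_nonneg (Real.rpow_nonneg (hx j).1.le _) (Real.rpow_nonneg (h1x j).le _))
    fun j _ => mul_le_mul ?_ ?_ (Real.rpow_nonneg (h1x j).le _) (Real.rpow_nonneg (hx j).1.le _)) ?_ (Real.rpow_nonneg hQ.le _)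
    (Finset.prod_nonneg fun j _ => mul_nonneg (Real.rpow_nonneg (hx j).1.le _) (Real.rpow_nonneg (h1x j).le _))
  · exact Real.rpow_le_rpow_of_exponent_ge (hx j).1 (hx j).2.le (by linarith)
  · exact Real.rpow_le_rpow_of_exponent_ge (h1x j) (by linarith [(hx j).1]) (by linarith)
  · exact Real.rpow_le_rpow_of_exponent_ge hQ hQ1 (by linarith)

/-- **The majorant of `∂_t F_t`** on the open cube (`k ≥ 1`): for `η > 0`, `M = ‖u₀‖ + Σ_j(‖u_j‖ + ‖v_j − u_j‖)`, `δ = η/2`,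
`ρ = η/(2(M+1))` and `‖t‖ ≤ ρ`,
`‖F_0(x) · L(x) · exp(t L(x))‖ ≤ (M/δ) · [typed real integrand at (Re a₀ + η; Re a_j − η | Re b_j − 2η)](x)`. -/
theorem norm_deriv_le {k : ℕ} (hk : 1 ≤ k) (a₀ u₀ : ℂ) (a b u v : ℕ → ℂ) {η : ℝ} (hη : 0 < η) {t : ℂ}
    (ht : ‖t‖ ≤ η / (2 * ((‖u₀‖ + ∑ j : Fin k, (‖u j‖ + ‖v j - u j‖)) + 1))) {x : Fin k → ℝ} (hx : ∀ j, x j ∈ Ioo (0 : ℝ) 1) :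
    ‖((∏ j : Fin k, ((x j : ℝ) : ℂ) ^ (a j - 1) * (1 - ((x j : ℝ) : ℂ)) ^ (b j - a j - 1)) *
          ((nestedQ (List.ofFn x) : ℝ) : ℂ) ^ (-a₀)) *
        ((∑ j : Fin k, (u j * Complex.log ((x j : ℝ) : ℂ) + (v j - u j) * Complex.log (1 - ((x j : ℝ) : ℂ)))) +
          -u₀ * Complex.log ((nestedQ (List.ofFn x) : ℝ) : ℂ)) *
        Complex.exp (t * ((∑ j : Fin k, (u j * Complex.log ((x j : ℝ) : ℂ) + (v j - u j) * Complex.log (1 - ((x j : ℝ) : ℂ)))) +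
          -u₀ * Complex.log ((nestedQ (List.ofFn x) : ℝ) : ℂ)))‖ ≤
      ((‖u₀‖ + ∑ j : Fin k, (‖u j‖ + ‖v j - u j‖)) / (η / 2)) *
        sorokinIntegrand k (a₀.re + η) (fun n => (a n).re - η) (fun n => (b n).re - 2 * η) x := by
  set M : ℝ := ‖u₀‖ + ∑ j : Fin k, (‖u j‖ + ‖v j - u j‖) with hM
  have hM0 : 0 ≤ M := by positivity
  have hQ := nestedQ_ofFn_mem_Ioo hk hx
  have hS₀ := norm_integrand k a₀ a b hx
  have hS₀nn : 0 ≤ sorokinIntegrand k a₀.re (fun n => (a n).re) (fun n => (b n).re) x := by rw [← hS₀]; exact norm_nonneg _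
  set ρ : ℝ := η / (2 * (M + 1)) with hρ
  have hρ0 : 0 ≤ ρ := by positivity
  have hL := norm_L_le u₀ u v hx hQ.1 hQ.2.le (half_pos hη)
  have hE := norm_exp_line_le u₀ u v ht hx hQ.1 hQ.2.le
  -- the exponential weight is dominated by the uniform weight with exponent `ρ M`
  have hE' : (∏ j : Fin k, x j ^ (-(ρ * ‖u j‖)) * (1 - x j) ^ (-(ρ * ‖v j - u j‖))) * nestedQ (List.ofFn x) ^ (-(ρ * ‖u₀‖)) ≤
      (∏ j : Fin k, x j ^ (-(ρ * M)) * (1 - x j) ^ (-(ρ * M))) * nestedQ (List.ofFn x) ^ (-(ρ * M)) := by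
    have h1x : ∀ j, 0 < 1 - x j := fun j => by linarith [(hx j).2]
    have hju : ∀ j : Fin k, ‖u j‖ ≤ M ∧ ‖v j - u j‖ ≤ M := fun j => by
      have hsum : ‖u j‖ + ‖v j - u j‖ ≤ ∑ i : Fin k, (‖u i‖ + ‖v i - u i‖) :=
        Finset.single_le_sum (f := fun i : Fin k => ‖u i‖ + ‖v i - u i‖) (fun i _ => by positivity) (Finset.mem_univ j)
      constructor <;> linarith [norm_nonneg u₀, norm_nonneg (u j), norm_nonneg (v j - u j)]
    have hu₀ : ‖u₀‖ ≤ M := by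
      have hsum : 0 ≤ ∑ i : Fin k, (‖u i‖ + ‖v i - u i‖) := Finset.sum_nonneg fun i _ => by positivity
      rw [hM]; linarith
    refine mul_le_mul (Finset.prod_le_prod (fun j _ => mul_nonneg (Real.rpow_nonneg (hx j).1.le _)
      (Real.rpow_nonneg (h1x j).le _)) fun j _ => mul_le_mul ?_ ?_ (Real.rpow_nonneg (h1x j).le _) (Real.rpow_nonneg (hx j).1.le _))
      ?_ (Real.rpow_nonneg hQ.1.le _) (Finset.prod_nonneg fun j _ => mul_nonneg (Real.rpow_nonneg (hx j).1.le _)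
        (Real.rpow_nonneg (h1x j).le _))
    · exact Real.rpow_le_rpow_of_exponent_ge (hx j).1 (hx j).2.le (by nlinarith [(hju j).1])
    · exact Real.rpow_le_rpow_of_exponent_ge (h1x j) (by linarith [(hx j).1]) (by nlinarith [(hju j).2])
    · exact Real.rpow_le_rpow_of_exponent_ge hQ.1 hQ.2.le (by nlinarith [hu₀])
  -- `δ + ρM ≤ η`
  have hρM : η / 2 + ρ * M ≤ η := by
    have : ρ * M ≤ η / 2 := by
      rw [hρ, div_mul_eq_mul_div, div_le_div_iff₀ (by positivity) (by norm_num)]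
      nlinarith
    linarith
  have hW := weight_mono hρM hx hQ.1 hQ.2.le
  -- assemble
  have hWnn : ∀ e : ℝ, 0 ≤ (∏ j : Fin k, x j ^ (-e) * (1 - x j) ^ (-e)) * nestedQ (List.ofFn x) ^ (-e) := fun e =>
    mul_nonneg (Finset.prod_nonneg fun j _ => mul_nonneg (Real.rpow_nonneg (hx j).1.le _)
      (Real.rpow_nonneg (by linarith [(hx j).2]) _)) (Real.rpow_nonneg hQ.1.le _)
  have hmerge : (∏ j : Fin k, x j ^ (-(η / 2)) * (1 - x j) ^ (-(η / 2))) * nestedQ (List.ofFn x) ^ (-(η / 2)) *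
      ((∏ j : Fin k, x j ^ (-(ρ * M)) * (1 - x j) ^ (-(ρ * M))) * nestedQ (List.ofFn x) ^ (-(ρ * M))) =
      (∏ j : Fin k, x j ^ (-(η / 2 + ρ * M)) * (1 - x j) ^ (-(η / 2 + ρ * M))) * nestedQ (List.ofFn x) ^ (-(η / 2 + ρ * M)) := by
    rw [mul_mul_mul_comm, ← Finset.prod_mul_distrib, ← Real.rpow_add hQ.1, show -(η / 2) + -(ρ * M) = -(η / 2 + ρ * M) by ring]
    congr 1
    refine Finset.prod_congr rfl fun j _ => ?_
    rw [mul_mul_mul_comm, ← Real.rpow_add (hx j).1, ← Real.rpow_add (by linarith [(hx j).2] : (0 : ℝ) < 1 - x j),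
      show -(η / 2) + -(ρ * M) = -(η / 2 + ρ * M) by ring]
  rw [norm_mul, norm_mul, hS₀]
  calc sorokinIntegrand k a₀.re (fun n => (a n).re) (fun n => (b n).re) x *
          ‖(∑ j : Fin k, (u j * Complex.log ((x j : ℝ) : ℂ) + (v j - u j) * Complex.log (1 - ((x j : ℝ) : ℂ)))) +
            -u₀ * Complex.log ((nestedQ (List.ofFn x) : ℝ) : ℂ)‖ *
          ‖Complex.exp (t * ((∑ j : Fin k, (u j * Complex.log ((x j : ℝ) : ℂ) +
            (v j - u j) * Complex.log (1 - ((x j : ℝ) : ℂ)))) + -u₀ * Complex.log ((nestedQ (List.ofFn x) : ℝ) : ℂ)))‖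
      ≤ sorokinIntegrand k a₀.re (fun n => (a n).re) (fun n => (b n).re) x *
          (M / (η / 2) * ((∏ j : Fin k, x j ^ (-(η / 2)) * (1 - x j) ^ (-(η / 2))) * nestedQ (List.ofFn x) ^ (-(η / 2)))) *
          ((∏ j : Fin k, x j ^ (-(ρ * M)) * (1 - x j) ^ (-(ρ * M))) * nestedQ (List.ofFn x) ^ (-(ρ * M))) :=
        mul_le_mul (mul_le_mul_of_nonneg_left hL hS₀nn) (hE.trans hE') (norm_nonneg _)
          (mul_nonneg hS₀nn (mul_nonneg (div_nonneg hM0 (by positivity)) (hWnn (η / 2))))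
    _ = M / (η / 2) * (sorokinIntegrand k a₀.re (fun n => (a n).re) (fun n => (b n).re) x *
          ((∏ j : Fin k, x j ^ (-(η / 2 + ρ * M)) * (1 - x j) ^ (-(η / 2 + ρ * M))) *
            nestedQ (List.ofFn x) ^ (-(η / 2 + ρ * M)))) := by rw [← hmerge]; ring
    _ ≤ M / (η / 2) * (sorokinIntegrand k a₀.re (fun n => (a n).re) (fun n => (b n).re) x *
          ((∏ j : Fin k, x j ^ (-η) * (1 - x j) ^ (-η)) * nestedQ (List.ofFn x) ^ (-η))) := by
        gcongr
    _ = _ := by rw [sorokinIntegrand_mul_weight k _ _ _ _ hx hQ.1]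

end Summit.KontsevichZagierPeriods.Zeta5Search.SorokinParameterLine

end
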